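import Mathlib
import Summits.Ventures.DiscreteObjects.Mahler.CyclotomicIntegerDescent

/-!
# Cyclotomic integers: the root-of-unity twist in the degenerate case, and the fibres of `μ ↦ μ^p` (venture `DiscreteObjects`, target L)

Cell `pub-namedobj`, seat `pub-namedobj-mahler-g28`. Framing: lottery ticket; floor = certified bounds/negative ranges.

Two more elementary pieces for the degenerate case of [cite: BombieriGubler2001, Theorem 4.4.9, Case II]
(Amoroso–Dvornicich 2000), `m = p n`, `σ_k : ζ ↦ ζ^k` with `k = 1 + n s`, `p ∤ s`:
* `aeval_pow_pow_eq_of_exists`: `g(μ₀)^p = g(μ₀^k)^p` for one primitive `m`-th root `μ₀` gives it for all;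
* `exists_twist_invariant`: in the degenerate case `g(ζ^k)^p = g(ζ)^p`, `g(ζ) ≠ 0`, one has `g(ζ^k) = ω^j g(ζ)` with
  `ω = ζ^n`, and the twisted cyclotomic integer `ζ^a g(ζ) = (X^a g)(ζ)`, `p ∣ a s + j`, is `σ_k`-invariant
  ("`ζ' α ∈ ℚ(ζ_{m/p})` for a root of unity `ζ'`");
* `prod_primitiveRoots_pow_prime_eq`: `μ ↦ μ^p` maps the primitive `m`-th roots of unity onto the primitive `n`-th roots
  with all fibres of size `e = φ(m)/φ(n)`, so `∏_μ F(μ^p) = (∏_θ F(θ))^e` (measure transfer under the descent).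
Elementary; no new mathematics claimed.
-/

namespace Summit.Ventures.DiscreteObjects.Mahler

open Polynomial Finset

/-- If `g(μ₀)^p = g(μ₀^k)^p` for ONE primitive `m`-th root of unity, then for all of them (irreducibility of `Φ_m`). -/
theorem aeval_pow_pow_eq_of_exists {m p k : ℕ} (hm0 : 0 < m) (g : ℤ[X]) {ζ : ℂ} (hζ : IsPrimitiveRoot ζ m)
    (h : ∃ μ ∈ primitiveRoots m ℂ, aeval μ g ^ p = aeval (μ ^ k) g ^ p) :
    aeval (ζ ^ k) g ^ p = aeval ζ g ^ p := by
  obtain ⟨μ, hμ, hμeq⟩ := h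
  have hμ' := (mem_primitiveRoots hm0).1 hμ
  set Q : ℤ[X] := g ^ p - (expand ℤ k g) ^ p with hQ
  have hQμ : aeval μ Q = 0 := by
    rw [hQ, map_sub, map_pow, map_pow, expand_aeval, hμeq, sub_self]
  have hQζ := aeval_eq_zero_of_primitiveRoot hm0 hμ' hQμ hζ
  rw [hQ, map_sub, map_pow, map_pow, expand_aeval, sub_eq_zero] at hQζ
  exact hQζ.symm

/-- **Twist.**  Let `m = p n`, `k = 1 + n s` with `p ∤ s`, `α = g(ζ) ≠ 0` with `g(ζ^k)^p = g(ζ)^p` (degenerate case).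
Then `g(ζ^k) = ω^j g(ζ)` for the `p`-th root of unity `ω = ζ^n`, and for `a` with `p ∣ a s + j` the cyclotomic
integer `ζ^a α = (X^a g)(ζ)` is `σ_k`-invariant: `(X^a g)(μ^k) = (X^a g)(μ)` for every primitive `m`-th root `μ`. -/
theorem exists_twist_invariant {m p n k s : ℕ} (hm0 : 0 < m) (hp : p.Prime) (hm : m = p * n)
    (hk : k = 1 + n * s) (hs : ¬ p ∣ s) (g : ℤ[X]) {ζ : ℂ} (hζ : IsPrimitiveRoot ζ m)
    (h0 : aeval ζ g ≠ 0) (hdeg : aeval (ζ ^ k) g ^ p = aeval ζ g ^ p) :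
    ∃ a : ℕ, ∀ μ : ℂ, IsPrimitiveRoot μ m → aeval (μ ^ k) (X ^ a * g) = aeval μ (X ^ a * g) := by
  haveI : NeZero p := ⟨hp.ne_zero⟩
  set ω : ℂ := ζ ^ n with hωdef
  have hω : IsPrimitiveRoot ω p := hζ.pow hm0 (by rw [hm, mul_comm])
  -- `g(ζ^k) = ω^j g(ζ)`
  set u : ℂ := aeval (ζ ^ k) g / aeval ζ g with hu
  have hup : u ^ p = 1 := by
    rw [hu, div_pow, hdeg, div_self (pow_ne_zero _ h0)]
  obtain ⟨j, -, hj⟩ := hω.eq_pow_of_pow_eq_one hup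
  have hgk : aeval (ζ ^ k) g = ω ^ j * aeval ζ g := by
    rw [hj, hu, div_mul_cancel₀ _ h0]
  -- `a` with `p ∣ a s + j`
  have hscop : s.Coprime p := Nat.coprime_comm.1 ((Nat.Prime.coprime_iff_not_dvd hp).2 hs)
  obtain ⟨c, -, hc⟩ := Nat.exists_mul_mod_eq_one_of_coprime hscop hp.one_lt
  set a : ℕ := c * ((p - 1) * j) with ha
  have hdiv : ∃ q : ℕ, a * s + j = p * q := by
    have h1 : s * c = p * (s * c / p) + 1 := by
      have := Nat.div_add_mod (s * c) p
      rw [hc] at this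
      exact this.symm
    refine ⟨s * c / p * ((p - 1) * j) + j, ?_⟩
    have hp1 : p - 1 + 1 = p := Nat.sub_add_cancel hp.one_lt.le
    calc a * s + j = s * c * ((p - 1) * j) + j := by rw [ha]; ring
      _ = (p * (s * c / p) + 1) * ((p - 1) * j) + j := by rw [← h1]
      _ = p * (s * c / p * ((p - 1) * j)) + ((p - 1) * j + j) := by ring
      _ = p * (s * c / p * ((p - 1) * j)) + p * j := by
          congr 1
          conv_rhs => rw [← hp1]
          ring
      _ = p * (s * c / p * ((p - 1) * j) + j) := by ring
  obtain ⟨q, hq⟩ := hdiv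
  refine ⟨a, ?_⟩
  -- invariance at `ζ`
  have hζinv : aeval (ζ ^ k) (X ^ a * g) = aeval ζ (X ^ a * g) := by
    rw [map_mul, map_pow, aeval_X, hgk, map_mul, map_pow, aeval_X, hωdef, ← pow_mul, ← pow_mul, ← mul_assoc,
      ← pow_add]
    congr 1
    refine pow_eq_pow_of_mod_eq hζ.pow_eq_one ?_
    have : k * a + n * j = a + m * q := by
      rw [hk, hm]
      calc (1 + n * s) * a + n * j = a + n * (a * s + j) := by ring
        _ = a + n * (p * q) := by rw [hq]
        _ = a + p * n * q := by ring
    rw [this, Nat.add_mul_mod_self_left]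
  -- invariance at every primitive root by conjugation
  intro μ hμ
  set Q : ℤ[X] := expand ℤ k (X ^ a * g) - X ^ a * g with hQ
  have hQζ : aeval ζ Q = 0 := by rw [hQ, map_sub, expand_aeval, hζinv, sub_self]
  have hQμ := aeval_eq_zero_of_primitiveRoot hm0 hζ hQζ hμ
  rw [hQ, map_sub, expand_aeval, sub_eq_zero] at hQμ
  exact hQμ

/-- **Fibre count.**  For a prime `p` and `m = p n`, the map `μ ↦ μ^p` sends the primitive `m`-th roots of unity
onto the primitive `n`-th roots of unity with all fibres of size `e = φ(m)/φ(n)` (`= p` if `p ∣ n`, `= p - 1` if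
`p ∤ n`); hence `∏_μ F(μ^p) = (∏_θ F(θ))^e`. -/
theorem prod_primitiveRoots_pow_prime_eq {m p n e : ℕ} (hm0 : 0 < m) (hp : p.Prime) (hm : m = p * n) (hn : 0 < n)
    (he : m.totient = e * n.totient) (F : ℂ → ℝ) :
    ∏ μ ∈ primitiveRoots m ℂ, F (μ ^ p) = (∏ θ ∈ primitiveRoots n ℂ, F θ) ^ e := by
  classical
  set S := primitiveRoots m ℂ with hS
  set T := primitiveRoots n ℂ with hT
  have hmaps : ∀ μ ∈ S, μ ^ p ∈ T := by
    intro μ hμ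
    exact (mem_primitiveRoots hn).2 (((mem_primitiveRoots hm0).1 hμ).pow hm0 hm)
  have hcardS : S.card = m.totient := (Complex.isPrimitiveRoot_exp m hm0.ne').card_primitiveRoots
  have hcardT : T.card = n.totient := (Complex.isPrimitiveRoot_exp n hn.ne').card_primitiveRoots
  -- fibre sizes are `≤ e`
  have htot : 0 < n.totient := Nat.totient_pos.2 hn
  have hle : ∀ θ ∈ T, (S.filter (fun μ => μ ^ p = θ)).card ≤ e := by
    intro θ hθ
    have hθ' := (mem_primitiveRoots hn).1 hθ
    have hsub : S.filter (fun μ => μ ^ p = θ) ⊆ Polynomial.nthRootsFinset p θ := by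
      intro μ hμ
      rw [Finset.mem_filter] at hμ
      exact (Polynomial.mem_nthRootsFinset hp.pos θ).2 hμ.2
    have hcardR : (Polynomial.nthRootsFinset p θ).card ≤ p := by
      rw [Polynomial.nthRootsFinset_def]
      exact (Multiset.toFinset_card_le _).trans (Polynomial.card_nthRoots p θ)
    by_cases hpn : p ∣ n
    · have hep : e = p := by
        rw [hm, Nat.totient_mul_of_prime_of_dvd hp hpn] at he
        exact (Nat.eq_of_mul_eq_mul_right htot he).symm
      rw [hep]
      exact (Finset.card_le_card hsub).trans hcardR
    · have hep : e = p - 1 := by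
        rw [hm, Nat.totient_mul_of_prime_of_not_dvd hp hpn] at he
        exact (Nat.eq_of_mul_eq_mul_right htot he).symm
      -- the non-primitive `p`-th root `θ^c` of `θ`, `p c ≡ 1 (mod n)`
      have hpcop : p.Coprime n := (Nat.Prime.coprime_iff_not_dvd hp).2 hpn
      obtain ⟨c, -, hc⟩ := Nat.exists_mul_mod_eq_of_coprime 1 hpcop hn.ne'
      have hx : (θ ^ c) ^ p = θ := by
        rw [← pow_mul]
        exact pow_eq_self_of_mod_eq hn hθ' (by rw [mul_comm]; exact hc)
      have hxR : θ ^ c ∈ Polynomial.nthRootsFinset p θ := (Polynomial.mem_nthRootsFinset hp.pos θ).2 hx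
      have hxS : θ ^ c ∉ S := by
        intro hxS
        have hprim := (mem_primitiveRoots hm0).1 hxS
        have h1 : (θ ^ c) ^ n = 1 := by rw [← pow_mul, mul_comm, pow_mul, hθ'.pow_eq_one, one_pow]
        have h2 : m ∣ n := hprim.dvd_of_pow_eq_one n h1
        have h3 : m ≤ n := Nat.le_of_dvd hn h2
        have h4 : 2 * n ≤ m := by rw [hm]; exact Nat.mul_le_mul_right n hp.two_le
        omega
      have hsub' : S.filter (fun μ => μ ^ p = θ) ⊆ (Polynomial.nthRootsFinset p θ).erase (θ ^ c) := by
        intro μ hμ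
        rw [Finset.mem_erase]
        refine ⟨?_, hsub hμ⟩
        rintro rfl
        exact hxS (Finset.mem_filter.1 hμ).1
      rw [hep]
      calc (S.filter (fun μ => μ ^ p = θ)).card ≤ ((Polynomial.nthRootsFinset p θ).erase (θ ^ c)).card :=
            Finset.card_le_card hsub'
        _ = (Polynomial.nthRootsFinset p θ).card - 1 := Finset.card_erase_of_mem hxR
        _ ≤ p - 1 := Nat.sub_le_sub_right hcardR 1
  -- hence all fibre sizes are `= e`
  have hsum : ∑ θ ∈ T, (S.filter (fun μ => μ ^ p = θ)).card = ∑ θ ∈ T, e := by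
    rw [← Finset.card_eq_sum_card_fiberwise (fun μ hμ => hmaps μ hμ), Finset.sum_const, smul_eq_mul, hcardS, hcardT,
      mul_comm]
    exact he
  have heq : ∀ θ ∈ T, (S.filter (fun μ => μ ^ p = θ)).card = e := (Finset.sum_eq_sum_iff_of_le hle).1 hsum
  -- the product
  rw [← Finset.prod_fiberwise_of_maps_to' (g := fun μ : ℂ => μ ^ p) hmaps F, ← Finset.prod_pow]
  refine Finset.prod_congr rfl fun θ hθ => ?_
  rw [Finset.prod_const, heq θ hθ]

end Summit.Ventures.DiscreteObjects.Mahler
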